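import Literature.Computability.AlgebraicComplexity.DegenerationSpectralMonotone
import HarnessLib

/-!
# The one-slice speedup: `R_h(t) ≤ r ⟹ t ⊕ ⟨1,r,1⟩ ⊴ ⟨r⟩ ⊕ ⟨1, |κ|+|μ|, 1⟩` (Strassen 1988; Coppersmith–Winograd 1982), explicit form

Topic `Literature/Computability/AlgebraicComplexity`. The mechanism by which a border-rank bound
on a tensor is converted into a *better* asymptotic bound ("`ω` is an infimum, not a minimum",
Coppersmith–Winograd 1982; Strassen 1988): starting from `t ⊴ ⟨r⟩` one adds a one-slice matrix
multiplication tensor `⟨1,s,1⟩` (a single matrix of rank `s`) on the right-hand side at no cost to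
the degeneration, and extracts — by the "free-lunch" kernel construction of Coppersmith–Winograd /
Strassen (arXiv:2605.21738, Thm. 5.1, Prop. 5.3–5.4, Thm. 6.1: "`T ⊕ ⟨1, r+s-2n, 1⟩ ⊴ ⟨r⟩ ⊕ ⟨1,s,1⟩`")
— a large one-slice summand `⟨1,t,1⟩` on the left-hand side.

## Content

* `oneSliceTensor K σ` — the one-slice tensor `⋆ ⊗ ∑_{x ∈ σ} e_x ⊗ e_x` (`≅ ⟨1,|σ|,1⟩`, a single
  identity matrix with a trivial first factor).
* `IsApproxDecomposition.isApproxRestriction_oneSliceSpeedup` — **the speedup, fully explicit**: from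
  an approximate decomposition `(u,v,w)` of order `h` with `r` triads of any `t : ι → κ → μ → K` (`K`
  a commutative ring), explicit polynomial matrices realising a degeneration of order `2h+2`
  `t ⊕ oneSlice(Fin r) ⊴ ⟨r⟩ ⊕ oneSlice(κ ⊕ μ)`, i.e. `t ⊕ ⟨1,r,1⟩ ⊴ ⟨r⟩ ⊕ ⟨1, |κ|+|μ|, 1⟩`.
  This is the instance `s = |κ| + |μ|`, fullness `r`, of arXiv:2605.21738 Thm. 6.1 (there with the
  sharper `s = n`, `t = r + s - 2n`, which needs a kernel computation; the weak form suffices for all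
  qualitative consequences and needs none: the garbage matrix `∑ᵢ vᵢ ⊗ wᵢ` is factored trivially
  through `K^κ`, and the relations among the `wᵢ` are supplied by `|μ|` extra slice coordinates).
* `algDegeneratesTo_oneSliceSpeedup` — `t ⊕ oneSlice(Fin bR(t)) ⊴ ⟨bR(t)⟩ ⊕ oneSlice(κ ⊕ μ)`.

## The construction (arXiv:2605.21738, proof of Thm. 5.1 with Prop. 5.4, specialised)

Source `S₀ = ⟨r⟩ ⊕ oneSlice(κ ⊕ μ)` on legs `(Fin r ⊕ ⋆, Fin r ⊕ (κ ⊕ μ), Fin r ⊕ (κ ⊕ μ))`, target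
`t ⊕ oneSlice(Fin r)` on legs `(ι ⊕ ⋆, κ ⊕ Fin r, μ ⊕ Fin r)`; `ε = X`, `k = h + 1`, `M = ∑ᵢ vᵢ ⊗ wᵢ`:
* first leg: `eᵢ ↦ ε^{h+2} uᵢ` on `ι`, `1` on `⋆`; `⋆' ↦ 0` on `ι`, `-1` on `⋆`;
* second leg: `eᵢ ↦ vᵢ` on `κ`, `ε^k [i = q]` on row `q`; `x_{b'} ↦ e_{b'}` on `κ`, `0` on rows `q`;
  `x_c ↦ 0` on `κ`, `ε^k w_q(c)` on row `q`;
* third leg: `eᵢ ↦ wᵢ` on `μ`, `ε^k [i = q']` on row `q'`; `y_b ↦ M_b = ∑ᵢ vᵢ(b) wᵢ` on `μ`,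
  `ε^k v_{q'}(b)` on row `q'`; `y_c ↦ e_c` on `μ`, `0` on rows `q'`.
Then `(A ⊗ B ⊗ C) S₀` equals `ε^{h+2} ∑ᵢ uᵢ⊗vᵢ⊗wᵢ = ε^{2h+2} t + O(ε^{2h+3})` on the `(ι,κ,μ)` block,
`ε^{2h+2} [q = q']` on the `(⋆, q, q')` block, vanishes identically on the other `⋆`-blocks (the
garbage `M - M`, `ε^k(v_{q'} - v_{q'})`, `ε^k(w_q - w_q)` cancels), and is `O(ε^{2h+3})` elsewhere.

## References

* arXiv:2605.21738, *Asymptotic Rank Speedup Theorems, Revisited* (2026), Thm. 5.1, Cor. 5.1,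
  Prop. 5.3, Prop. 5.4 ("One-slice speedup [Str88]"), Thm. 6.1, Cor. 6.1 (J. Alman, B. Li). [AlmanLi2026]
* V. Strassen, *The asymptotic spectrum of tensors*, J. reine angew. Math. 384 (1988) 102–152.
  [Strassen1988]
* D. Coppersmith, S. Winograd, *On the asymptotic complexity of matrix multiplication*, SIAM J.
  Comput. 11 (1982) 472–492 (primary source of the speedup for isolated slices; not held).
  [CoppersmithWinograd1982]
-/

noncomputable section

open scoped BigOperators Polynomial
open Polynomial

namespace Literature.Computability.AlgebraicComplexity

universe u

/-! ## The one-slice tensor -/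

section OneSlice

variable (K : Type u) [CommSemiring K]

/-- The **one-slice tensor** on `σ`: `oneSlice(σ) = ⋆ ⊗ ∑_{x ∈ σ} e_x ⊗ e_x ∈ K^1 ⊗ K^σ ⊗ K^σ`, an
identity matrix with a trivial first factor (`≅ ⟨1, |σ|, 1⟩`, the tensor of one inner product of
length `|σ|`; arXiv:2605.21738, §5.3 "one-slice matrix multiplication tensor").
[cite: AlmanLi2026, §5.3] -/
def oneSliceTensor (σ : Type*) [DecidableEq σ] : Unit → σ → σ → K :=
  fun _ x y => if x = y then 1 else 0

/-- Entries of the one-slice tensor. [folklore] -/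
@[simp] theorem oneSliceTensor_apply {σ : Type*} [DecidableEq σ] (z : Unit) (x y : σ) :
    oneSliceTensor K σ z x y = if x = y then 1 else 0 := rfl

/-- Relabelling a one-slice tensor along a bijection gives the one-slice tensor. [folklore] -/
theorem oneSliceTensor_reindex {σ τ : Type*} [DecidableEq σ] [DecidableEq τ] (e : τ ≃ σ) :
    (fun z x y => oneSliceTensor K σ z (e x) (e y)) = oneSliceTensor K τ := by
  funext z x y
  simp [e.apply_eq_iff_eq]

/-- `oneSlice(σ) ≥ oneSlice(τ)` whenever `τ` embeds into `σ` (zero out the other coordinates).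
[cite: AlmanLi2026, §5.4] -/
theorem tensorRestrictsTo_oneSliceTensor_of_embedding {σ τ : Type*} [Fintype σ] [DecidableEq σ]
    [DecidableEq τ] (e : τ ↪ σ) :
    TensorRestrictsTo (oneSliceTensor K σ) (oneSliceTensor K τ) := by
  have h : oneSliceTensor K τ = fun z x y => oneSliceTensor K σ (id z) (e x) (e y) := by
    funext z x y
    simp [e.apply_eq_iff_eq]
  rw [h]
  exact tensorRestrictsTo_precomp _ _ _ _

end OneSlice

/-! ## The explicit one-slice speedup -/

section Speedup

variable {K : Type u} [CommRing K]
variable {ι κ μ : Type*} [Fintype ι] [Fintype κ] [Fintype μ] [DecidableEq ι] [DecidableEq κ]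
  [DecidableEq μ]

omit [Fintype ι] [Fintype κ] [Fintype μ] [DecidableEq ι] [DecidableEq κ] [DecidableEq μ] in
/-- Mixed positions of a direct sum vanish (third index in the other block). [folklore] -/
@[simp] theorem directSumTensor_mixed₃_inr {ι' κ' μ' : Type*} (s : ι → κ → μ → K)
    (t : ι' → κ' → μ' → K) (a : ι) (b : κ) (c : μ') :
    directSumTensor s t (Sum.inl a) (Sum.inl b) (Sum.inr c) = 0 := rfl

omit [Fintype ι] [Fintype κ] [Fintype μ] [DecidableEq ι] [DecidableEq κ] [DecidableEq μ] in
/-- Mixed positions of a direct sum vanish (third index in the other block). [folklore] -/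
@[simp] theorem directSumTensor_mixed₃_inl {ι' κ' μ' : Type*} (s : ι → κ → μ → K)
    (t : ι' → κ' → μ' → K) (a : ι') (b : κ') (c : μ) :
    directSumTensor s t (Sum.inr a) (Sum.inr b) (Sum.inl c) = 0 := rfl

/-- Sums against the source `⟨r⟩ ⊕ oneSlice(σ)`: only the diagonal of the unit tensor and the
diagonal of the slice contribute. [folklore] -/
theorem sum_directSum_unitTensor_oneSliceTensor {σ : Type*} [Fintype σ] [DecidableEq σ] (r : ℕ)
    (f : Fin r ⊕ Unit → K[X]) (g k : Fin r ⊕ σ → K[X]) :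
    (∑ p, ∑ p', ∑ p'', f p * g p' * k p'' *
      Polynomial.C (directSumTensor (unitTensor K r) (oneSliceTensor K σ) p p' p'')) =
      (∑ i, f (Sum.inl i) * g (Sum.inl i) * k (Sum.inl i)) +
        ∑ x, f (Sum.inr ()) * g (Sum.inr x) * k (Sum.inr x) := by
  simp only [Fintype.sum_sum_type, directSumTensor_inl, directSumTensor_inr, directSumTensor_inl_inr,
    directSumTensor_inr_inl, directSumTensor_mixed₃_inr, directSumTensor_mixed₃_inl, unitTensor_apply,
    oneSliceTensor_apply, map_zero, mul_zero, Finset.sum_const_zero, add_zero, zero_add,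
    Fintype.sum_unique]
  congr 1
  · refine Finset.sum_congr rfl fun i _ => ?_
    rw [Finset.sum_eq_single i (fun j _ hj => by simp [Ne.symm hj]) (by simp),
      Finset.sum_eq_single i (fun l _ hl => by simp [Ne.symm hl]) (by simp)]
    simp
  · refine Finset.sum_congr rfl fun x _ => ?_
    rw [Finset.sum_eq_single x (fun y _ hy => by simp [Ne.symm hy]) (by simp)]
    simp

/-- The first-leg matrix of the speedup. [cite: AlmanLi2026, Thm. 5.1 (proof)] -/
def speedupA (h r : ℕ) (u : Fin r → ι → K[X]) : ι ⊕ Unit → Fin r ⊕ Unit → K[X]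
  | Sum.inl a, Sum.inl i => X ^ (h + 2) * u i a
  | Sum.inl _, Sum.inr _ => 0
  | Sum.inr _, Sum.inl _ => 1
  | Sum.inr _, Sum.inr _ => -1

/-- The second-leg matrix of the speedup. [cite: AlmanLi2026, Thm. 5.1 (proof)] -/
def speedupB (h r : ℕ) (v : Fin r → κ → K[X]) (w : Fin r → μ → K[X]) :
    κ ⊕ Fin r → Fin r ⊕ (κ ⊕ μ) → K[X]
  | Sum.inl b, Sum.inl i => v i b
  | Sum.inl b, Sum.inr (Sum.inl b') => if b = b' then 1 else 0
  | Sum.inl _, Sum.inr (Sum.inr _) => 0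
  | Sum.inr q, Sum.inl i => if i = q then X ^ (h + 1) else 0
  | Sum.inr _, Sum.inr (Sum.inl _) => 0
  | Sum.inr q, Sum.inr (Sum.inr c) => X ^ (h + 1) * w q c

/-- The third-leg matrix of the speedup. [cite: AlmanLi2026, Thm. 5.1 (proof)] -/
def speedupC (h r : ℕ) (v : Fin r → κ → K[X]) (w : Fin r → μ → K[X]) :
    μ ⊕ Fin r → Fin r ⊕ (κ ⊕ μ) → K[X]
  | Sum.inl c, Sum.inl i => w i c
  | Sum.inl c, Sum.inr (Sum.inl b) => ∑ i, v i b * w i c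
  | Sum.inl c, Sum.inr (Sum.inr c') => if c' = c then 1 else 0
  | Sum.inr q', Sum.inl i => if i = q' then X ^ (h + 1) else 0
  | Sum.inr q', Sum.inr (Sum.inl b) => X ^ (h + 1) * v q' b
  | Sum.inr _, Sum.inr (Sum.inr _) => 0

/-- Coefficients of `X^n p` at and below `n + h`, from those of `p` at and below `h`. [folklore] -/
theorem coeff_X_pow_mul_of_coeff_eq_ite {p : K[X]} {h n : ℕ} {x : K}
    (hp : ∀ j ≤ h, p.coeff j = if j = h then x else 0) (j : ℕ) (hj : j ≤ n + h) :
    (X ^ n * p).coeff j = if j = n + h then x else 0 := by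
  rw [Polynomial.coeff_X_pow_mul']
  split_ifs with hnj hjh hjh'
  · rw [hp (j - n) (by omega), if_pos (by omega)]
  · rw [hp (j - n) (by omega), if_neg (by omega)]
  · omega
  · rfl

/-- Coefficients of `X^n p` vanish below `n`. [folklore] -/
theorem coeff_X_pow_mul_eq_zero_of_lt {p : K[X]} {n j : ℕ} (hj : j < n) :
    (X ^ n * p).coeff j = 0 := by
  rw [Polynomial.coeff_X_pow_mul', if_neg (by omega)]

omit [Fintype ι] [DecidableEq ι] in
/-- **The one-slice speedup, explicit form** (Strassen 1988; Coppersmith–Winograd 1982;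
arXiv:2605.21738, Thm. 5.1 + Prop. 5.4 + Thm. 6.1 with `s = |κ| + |μ|`): an approximate decomposition
of order `h` with `r` triads of `t : ι → κ → μ → K` yields, by the matrices `speedupA/B/C`, a
degeneration of order `2h + 2`
`t ⊕ oneSlice(Fin r) ⊴ ⟨r⟩ ⊕ oneSlice(κ ⊕ μ)`, i.e. `t ⊕ ⟨1,r,1⟩ ⊴ ⟨r⟩ ⊕ ⟨1,|κ|+|μ|,1⟩`.
[cite: AlmanLi2026, Thm. 6.1] -/
theorem IsApproxDecomposition.isApproxRestriction_oneSliceSpeedup {h r : ℕ} {t : ι → κ → μ → K}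
    {u : Fin r → ι → K[X]} {v : Fin r → κ → K[X]} {w : Fin r → μ → K[X]}
    (hd : IsApproxDecomposition h t u v w) :
    IsApproxRestriction (2 * h + 2) (directSumTensor (unitTensor K r) (oneSliceTensor K (κ ⊕ μ)))
      (directSumTensor t (oneSliceTensor K (Fin r))) (speedupA h r u) (speedupB h r v w)
      (speedupC h r v w) := by
  intro x y z j hj
  rw [sum_directSum_unitTensor_oneSliceTensor]
  rcases x with a | ⟨⟩ <;> rcases y with b | q <;> rcases z with c | q'
  · -- `(ι, κ, μ)`: `ε^{h+2} ∑ᵢ uᵢ vᵢ wᵢ`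
    have e : ((∑ i, speedupA h r u (Sum.inl a) (Sum.inl i) * speedupB h r v w (Sum.inl b) (Sum.inl i) *
        speedupC h r v w (Sum.inl c) (Sum.inl i)) +
        ∑ x, speedupA h r u (Sum.inl a) (Sum.inr ()) * speedupB h r v w (Sum.inl b) (Sum.inr x) *
          speedupC h r v w (Sum.inl c) (Sum.inr x)) =
        X ^ (h + 2) * ∑ i, u i a * v i b * w i c := by
      simp only [speedupA, speedupB, speedupC, zero_mul, Finset.sum_const_zero, add_zero,
        Finset.mul_sum]
      exact Finset.sum_congr rfl fun i _ => by ring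
    rw [e, coeff_X_pow_mul_of_coeff_eq_ite (hd a b c) j (by omega)]
    simp only [directSumTensor_inl]
    split_ifs <;> first | rfl | omega
  · -- `(ι, κ, q')`: `O(ε^{2h+3})`
    have e : ((∑ i, speedupA h r u (Sum.inl a) (Sum.inl i) * speedupB h r v w (Sum.inl b) (Sum.inl i) *
        speedupC h r v w (Sum.inr q') (Sum.inl i)) +
        ∑ x, speedupA h r u (Sum.inl a) (Sum.inr ()) * speedupB h r v w (Sum.inl b) (Sum.inr x) *
          speedupC h r v w (Sum.inr q') (Sum.inr x)) =
        X ^ (2 * h + 3) * (u q' a * v q' b) := by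
      simp only [speedupA, speedupB, speedupC, zero_mul, Finset.sum_const_zero, add_zero, mul_ite,
        mul_zero]
      rw [Finset.sum_eq_single q' (fun i _ hi => if_neg hi) (by simp), if_pos rfl]
      ring
    rw [e, coeff_X_pow_mul_eq_zero_of_lt (by omega)]
    simp only [directSumTensor_mixed₃_inr]
    split_ifs <;> rfl
  · -- `(ι, q, μ)`: `O(ε^{2h+3})`
    have e : ((∑ i, speedupA h r u (Sum.inl a) (Sum.inl i) * speedupB h r v w (Sum.inr q) (Sum.inl i) *
        speedupC h r v w (Sum.inl c) (Sum.inl i)) +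
        ∑ x, speedupA h r u (Sum.inl a) (Sum.inr ()) * speedupB h r v w (Sum.inr q) (Sum.inr x) *
          speedupC h r v w (Sum.inl c) (Sum.inr x)) =
        X ^ (2 * h + 3) * (u q a * w q c) := by
      simp only [speedupA, speedupB, speedupC, zero_mul, Finset.sum_const_zero, add_zero, mul_ite,
        mul_zero, ite_mul, zero_mul]
      rw [Finset.sum_eq_single q (fun i _ hi => if_neg hi) (by simp), if_pos rfl]
      ring
    rw [e, coeff_X_pow_mul_eq_zero_of_lt (by omega)]
    simp only [directSumTensor_inl_inr]
    split_ifs <;> rfl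
  · -- `(ι, q, q')`: `O(ε^{3h+4})`
    have e : ((∑ i, speedupA h r u (Sum.inl a) (Sum.inl i) * speedupB h r v w (Sum.inr q) (Sum.inl i) *
        speedupC h r v w (Sum.inr q') (Sum.inl i)) +
        ∑ x, speedupA h r u (Sum.inl a) (Sum.inr ()) * speedupB h r v w (Sum.inr q) (Sum.inr x) *
          speedupC h r v w (Sum.inr q') (Sum.inr x)) =
        X ^ (3 * h + 4) * (if q = q' then u q a else 0) := by
      simp only [speedupA, speedupB, speedupC, zero_mul, Finset.sum_const_zero, add_zero, mul_ite,
        mul_zero, ite_mul, zero_mul]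
      rw [Finset.sum_eq_single q' (fun i _ hi => if_neg hi) (by simp), if_pos rfl]
      by_cases hqq : q = q'
      · subst hqq
        rw [if_pos rfl, if_pos rfl]
        ring
      · rw [if_neg (Ne.symm hqq), if_neg hqq]
    rw [e, coeff_X_pow_mul_eq_zero_of_lt (by omega)]
    simp only [directSumTensor_inl_inr]
    split_ifs <;> rfl
  · -- `(⋆, κ, μ)`: the garbage `M - M = 0`
    have e : ((∑ i, speedupA h r u (Sum.inr ()) (Sum.inl i) * speedupB h r v w (Sum.inl b) (Sum.inl i) *
        speedupC h r v w (Sum.inl c) (Sum.inl i)) +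
        ∑ x, speedupA h r u (Sum.inr ()) (Sum.inr ()) * speedupB h r v w (Sum.inl b) (Sum.inr x) *
          speedupC h r v w (Sum.inl c) (Sum.inr x)) = 0 := by
      simp only [speedupA, speedupB, speedupC, one_mul, Fintype.sum_sum_type, zero_mul,
        Finset.sum_const_zero, add_zero, neg_mul, ite_mul, Finset.sum_neg_distrib, Finset.sum_ite_eq,
        Finset.mem_univ, if_true]
      exact add_neg_cancel _
    rw [e, Polynomial.coeff_zero]
    simp only [directSumTensor_inr_inl]
    split_ifs <;> rfl
  · -- `(⋆, κ, q')`: `ε^k (v_{q'} - v_{q'}) = 0`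
    have e : ((∑ i, speedupA h r u (Sum.inr ()) (Sum.inl i) * speedupB h r v w (Sum.inl b) (Sum.inl i) *
        speedupC h r v w (Sum.inr q') (Sum.inl i)) +
        ∑ x, speedupA h r u (Sum.inr ()) (Sum.inr ()) * speedupB h r v w (Sum.inl b) (Sum.inr x) *
          speedupC h r v w (Sum.inr q') (Sum.inr x)) = 0 := by
      simp only [speedupA, speedupB, speedupC, one_mul, Fintype.sum_sum_type, mul_zero, zero_mul,
        Finset.sum_const_zero, add_zero, neg_mul, ite_mul, mul_ite, Finset.sum_neg_distrib,
        Finset.sum_ite_eq, Finset.sum_ite_eq', Finset.mem_univ, if_true]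
      ring
    rw [e, Polynomial.coeff_zero]
    simp only [directSumTensor_inr_inl]
    split_ifs <;> rfl
  · -- `(⋆, q, μ)`: `ε^k (w_q - w_q) = 0`
    have e : ((∑ i, speedupA h r u (Sum.inr ()) (Sum.inl i) * speedupB h r v w (Sum.inr q) (Sum.inl i) *
        speedupC h r v w (Sum.inl c) (Sum.inl i)) +
        ∑ x, speedupA h r u (Sum.inr ()) (Sum.inr ()) * speedupB h r v w (Sum.inr q) (Sum.inr x) *
          speedupC h r v w (Sum.inl c) (Sum.inr x)) = 0 := by
      simp only [speedupA, speedupB, speedupC, one_mul, Fintype.sum_sum_type, mul_zero, zero_mul,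
        Finset.sum_const_zero, zero_add, neg_mul, ite_mul, mul_ite, mul_one, Finset.sum_neg_distrib,
        Finset.sum_ite_eq', Finset.mem_univ, if_true]
      ring
    rw [e, Polynomial.coeff_zero]
    simp only [directSumTensor_mixed₃_inl]
    split_ifs <;> rfl
  · -- `(⋆, q, q')`: `ε^{2h+2} [q = q']`
    have e : ((∑ i, speedupA h r u (Sum.inr ()) (Sum.inl i) * speedupB h r v w (Sum.inr q) (Sum.inl i) *
        speedupC h r v w (Sum.inr q') (Sum.inl i)) +
        ∑ x, speedupA h r u (Sum.inr ()) (Sum.inr ()) * speedupB h r v w (Sum.inr q) (Sum.inr x) *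
          speedupC h r v w (Sum.inr q') (Sum.inr x)) =
        X ^ (2 * h + 2) * Polynomial.C (if q = q' then 1 else 0) := by
      simp only [speedupA, speedupB, speedupC, one_mul, Fintype.sum_sum_type, mul_zero, zero_mul,
        Finset.sum_const_zero, add_zero, ite_mul, mul_ite]
      rw [Finset.sum_eq_single q' (fun i _ hi => if_neg hi) (by simp), if_pos rfl]
      by_cases hqq : q = q'
      · subst hqq
        rw [if_pos rfl, if_pos rfl, map_one, mul_one]
        ring
      · rw [if_neg (Ne.symm hqq), if_neg hqq, map_zero, mul_zero]
    rw [e, Polynomial.coeff_X_pow_mul']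
    simp only [directSumTensor_inr, oneSliceTensor_apply, Polynomial.coeff_C]
    split_ifs <;> first | rfl | omega

/-- **One-slice speedup from a border-rank bound**: `t ⊕ oneSlice(Fin bR(t)) ⊴ ⟨bR(t)⟩ ⊕ oneSlice(κ ⊕ μ)`
(`t ⊕ ⟨1, bR(t), 1⟩ ⊴ ⟨bR(t)⟩ ⊕ ⟨1, |κ|+|μ|, 1⟩`; arXiv:2605.21738, Thm. 6.1 "in particular, if
`r ≥ n`, `T ⊕ ⟨1,r-n,1⟩ ⊴ ⟨r⟩ ⊕ ⟨1,n,1⟩`", weak form; Strassen 1988). [cite: AlmanLi2026, Thm. 6.1] -/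
theorem algDegeneratesTo_oneSliceSpeedup (t : ι → κ → μ → K) :
    AlgDegeneratesTo (directSumTensor (unitTensor K (algBorderRank t)) (oneSliceTensor K (κ ⊕ μ)))
      (directSumTensor t (oneSliceTensor K (Fin (algBorderRank t)))) := by
  obtain ⟨h, hh⟩ := exists_algBorderRank_eq_approxRank t
  obtain ⟨u, v, w, huvw⟩ := exists_isApproxDecomposition_approxRank h t
  rw [hh]
  exact ⟨2 * h + 2, _, _, _, huvw.isApproxRestriction_oneSliceSpeedup⟩

end Speedup

end Literature.Computability.AlgebraicComplexity

end
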